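import Summits.ValiantsHypothesis.ValiantsHypothesis.Theorems.LacunarySymmetroidMatrixDescartesCensusAtomM6K5EB75
import Summits.ValiantsHypothesis.ValiantsHypothesis.Theorems.LacunarySymmetroidMatrixDescartesCensusAtomM6K4QF53
import Summits.ValiantsHypothesis.ValiantsHypothesis.Theorems.LacunarySymmetroidMatrixDescartesCensusAtomM6K3S63
import Summits.ValiantsHypothesis.ValiantsHypothesis.Theorems.LacunarySymmetroidMatrixDescartesCensusRowLawM4

/-!
# `MatrixDescartes` census — THE `m = 6` ROW LAW: `ζ_sym(6,K) ≥ 75·⌊(K−1)/4⌋ + {0, 6, 27, 53}` for EVERY `K ≥ 5` (slope `18.75` per letter)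

HONEST FRAMING.  Experiment cell `val-V1-extremal`, width seat val-v1x-eng-9 g3 (`--supports stmt-ValiantsHypothesis-18050 --as helper`).
LOWER-bound / construction mathematics in census (CONJECTURE-A) currency: explicit real symmetric lacunary `6 × 6` pencils with many distinct
positive determinant roots, for every number of letters `K`.  It proves NOTHING about the crux `Theses.LacunarySymmetroid.MatrixDescartes`
(stmt-ValiantsHypothesis-18050 — an UPPER bound at fat formats; a fixed-`m` row is polynomial in `K`), nothing about `DoorA26` / `DoorA34`,
nothing about `VP ≠ VNP`; VP ≠ VNP is NOT proved.  No definitions, no `sorry`.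

THE LAW.  For every `K ≥ 5`, writing `K − 1 = 4j + r` (`0 ≤ r < 4`): `ζ_sym(6,K) ≥ 75j + c_r`, `c = (0, 6, 27, 53)` (`row_r0` … `row_r3`), `K`-slope
`75/4 = 18.75` per letter; closed forms `rowLaw` (`75·⌊(K−1)/4⌋ + 6·((K−1) mod 4)`) and `rowLaw_linear` (`18K − 27`).  Before this file the tree's
all-`K` statements at `m = 6` were `VSQ.gen_law` (`16K − 31`, slope `16` = the `P4` chain ladder's `48` per `3` letters); val-v1x-eng-8 g3's finite
block words `MixM6` (`(6,7) 106`, `(6,8) 128`, `(6,10) 159`, `(6,11) 181`, `(6,12) 203`, `(6,13) 225`) use `QUADFLAG53` periods as well and are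
BETTER than this ladder by `3–4` at `K ≡ 2, 3 (mod 4)`, `K ≤ 13` — new here is the statement for every `K` (asymptotically `ENDBOTH75`'s `18.75`
per letter beats `QUADFLAG53`'s `17.67`).  SUB-`P`: `P(6,K) = 21K − 36` has slope `21 > 18.75`; the located `m = 6` atoms do not decide «P-tracking».

MECHANISM (bookkeeping over kernel-certified blocks of val-v1x-eng-8 g3's atom bank; `Chain.chain_append` = the tree's junction law for matching
junction inertia, seat val-sym-mdr-p1; `Reflect.block_reverse` = `x ↦ 1/x`).  Period = val-v1x-eng-2 g2's `ENDBOTH75` (`(6,5) ≥ 75`, block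
`AtomM6K5EB75`, end inertias bottom `(4,2)`, top `(3,3)` — NOT self-matching), so the ladder alternates the block with its REVERSAL:
`E ▹ Eʳ ▹ E ▹ Eʳ ▹ …` (this is the tree's `Chain.exists_alternating_ladder` pattern, here with the Sylvester forms carried along so that terminal blocks
can be attached): `chainE` (odd number of blocks, top `(3,3)`), `chainO` (even, top `(4,2)`).  Terminal pieces: on a `(3,3)` end the lead's `(6,3)` native
`S-6-3` (`AtomM6K3S63.block`, `+2` letters, `+27`) or eng-2's `QUADFLAG53` reversed (`block_reverse AtomM6K4QF53.block`, `+3` letters, `+53`); on a `(4,2)`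
end `QUADFLAG53` itself or `S-6-3` reversed; or one grafted letter (`+6`).
Credits: rows val-v1x-eng-2 g2 (ENDBOTH75, QUADFLAG53), pub-symmetroid lead (S-6-3); block kit + atom bank val-v1x-eng-8 g3; junction / ladder calculus
val-sym-mdr-p1.  [folklore] throughout (Sylvester's law of inertia, intermediate value theorem — inside the cited tree lemmas).
-/

-- `Summit.ValiantsHypothesis.ValiantsHypothesis.…` repeats a component by the D-0017 layout
-- (single-conjunct summit), which the `dupNamespace` linter flags; the name is mandated.
set_option linter.dupNamespace false

namespace Summit.ValiantsHypothesis.ValiantsHypothesis.Theorems.LacunarySymmetroidMatrixDescartes.Census.Reflect.RowLawM6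

open Summit.ValiantsHypothesis.ValiantsHypothesis.Theorems.MatrixDescartes.Negative (PosRootLawAt)
open Summit.ValiantsHypothesis.ValiantsHypothesis.Theorems.LacunarySymmetroidMatrixDescartes.Census
open Summit.ValiantsHypothesis.ValiantsHypothesis.Theorems.LacunarySymmetroidMatrixDescartes.Census.Reflect
open Summit.ValiantsHypothesis.ValiantsHypothesis.Theorems.LacunarySymmetroidMatrixDescartes.Census.Reflect.RowLawM4 (mono)
open scoped BigOperators Matrix

/-! ### The periodic ladder `E ▹ Eʳ ▹ E ▹ …` (`E = AtomM6K5EB75`) -/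

/-- **Odd-count ladder**: `E ▹ (Eʳ ▹ E)^q` — a chain with `8q + 5` letters, `150q + 75` alternations and top Sylvester form of inertia `(3,3)`.
[folklore] -/
theorem chainE (q : ℕ) : ∃ (d : Fin (8 * q + 4 + 1) → ℕ) (S : Fin (8 * q + 4 + 1) → Matrix (Fin 6) (Fin 6) ℝ)
      (τ : Fin (150 * q + 75 + 1) → ℝ),
    StrictMono d ∧ (∀ h1 : 0 < 8 * q + 4 + 1, ∃ C : Matrix (Fin 6) (Fin 6) ℝ, C.det ≠ 0 ∧
      Cᵀ * S ⟨8 * q + 4 + 1 - 1, Nat.sub_lt h1 one_pos⟩ * C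
        = Matrix.diagonal (![(1 : ℝ), (1 : ℝ), (1 : ℝ), (-1 : ℝ), (-1 : ℝ), (-1 : ℝ)] : Fin 6 → ℝ)) ∧
    (∀ l, (S l).IsSymm) ∧ StrictMono τ ∧ (∀ j, 0 < τ j) ∧ (∀ j, (∑ l, τ j ^ d l • S l).det ≠ 0) ∧
    ∀ j : Fin (150 * q + 75), (∑ l, τ j.castSucc ^ d l • S l).det * (∑ l, τ j.succ ^ d l • S l).det < 0 := by
  induction q with
  | zero =>
    exact Chain.certificateT_transport (by norm_num) (by norm_num) (Chain.chain_of_block AtomM6K5EB75.block)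
  | succ q ih =>
    -- append `Eʳ` (bottom inertia `(3,3)` = the chain's top) …
    have h1 := Chain.chain_append (K₁ := 8 * q + 4) (K₂ := 4) (by norm_num) ih (block_reverse AtomM6K5EB75.block)
      (Equiv.refl (Fin 6)) (by intro i; fin_cases i <;> norm_num)
    -- … then `E` (bottom inertia `(4,2)` = the new top)
    have h2 := Chain.chain_append (K₁ := 8 * q + 8) (K₂ := 4) (by norm_num)
      (Chain.certificateT_transport (by ring) rfl h1) AtomM6K5EB75.block
      (Equiv.refl (Fin 6)) (by intro i; fin_cases i <;> norm_num)
    exact Chain.certificateT_transport (by ring) (by ring) h2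

/-- **Even-count ladder**: `E ▹ (Eʳ ▹ E)^q ▹ Eʳ` — a chain with `8q + 9` letters, `150q + 150` alternations and top form of inertia `(4,2)`. [folklore] -/
theorem chainO (q : ℕ) : ∃ (d : Fin (8 * q + 8 + 1) → ℕ) (S : Fin (8 * q + 8 + 1) → Matrix (Fin 6) (Fin 6) ℝ)
      (τ : Fin (150 * q + 150 + 1) → ℝ),
    StrictMono d ∧ (∀ h1 : 0 < 8 * q + 8 + 1, ∃ C : Matrix (Fin 6) (Fin 6) ℝ, C.det ≠ 0 ∧
      Cᵀ * S ⟨8 * q + 8 + 1 - 1, Nat.sub_lt h1 one_pos⟩ * C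
        = Matrix.diagonal (![(1 : ℝ), (1 : ℝ), (1 : ℝ), (1 : ℝ), (-1 : ℝ), (-1 : ℝ)] : Fin 6 → ℝ)) ∧
    (∀ l, (S l).IsSymm) ∧ StrictMono τ ∧ (∀ j, 0 < τ j) ∧ (∀ j, (∑ l, τ j ^ d l • S l).det ≠ 0) ∧
    ∀ j : Fin (150 * q + 150), (∑ l, τ j.castSucc ^ d l • S l).det * (∑ l, τ j.succ ^ d l • S l).det < 0 := by
  have h1 := Chain.chain_append (K₁ := 8 * q + 4) (K₂ := 4) (by norm_num) (chainE q) (block_reverse AtomM6K5EB75.block)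
    (Equiv.refl (Fin 6)) (by intro i; fin_cases i <;> norm_num)
  exact Chain.certificateT_transport (by ring) (by ring) h1

/-! ### Rows by residue of `K − 1 (mod 4)` -/

/-- **`K = 4j+5`: `ζ_sym(6, 4j+5) ≥ 75(j+1)`** (`j = 0` is `ENDBOTH75`, `j = 1` the self-chain `(6,9) ≥ 150`, `j = 2` is `(6,13) ≥ 225`). [folklore] -/
theorem row_r0 (j : ℕ) : ¬ PosRootLawAt 6 (4 * j + 5) (75 * j + 74) := by
  obtain ⟨q, rfl | rfl⟩ := Nat.even_or_odd' j
  · have h := Chain.not_posRootLawAt_of_certificateT (by omega) (chainE q)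
    rw [show 4 * (2 * q) + 5 = 8 * q + 4 + 1 by ring, show 75 * (2 * q) + 74 = 150 * q + 75 - 1 by omega]
    exact h
  · have h := Chain.not_posRootLawAt_of_certificateT (by omega) (chainO q)
    rw [show 4 * (2 * q + 1) + 5 = 8 * q + 8 + 1 by ring, show 75 * (2 * q + 1) + 74 = 150 * q + 150 - 1 by omega]
    exact h

/-- **`K = 4j+6`: `ζ_sym(6, 4j+6) ≥ 75(j+1) + 6`** (one grafted letter). [folklore] -/
theorem row_r1 (j : ℕ) : ¬ PosRootLawAt 6 (4 * j + 6) (75 * j + 80) := by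
  obtain ⟨q, rfl | rfl⟩ := Nat.even_or_odd' j
  · have h := not_posRootLawAt_of_certificateT_add (by omega) (chainE q) 1
    rw [show 4 * (2 * q) + 6 = 8 * q + 4 + 1 + 1 by ring, show 75 * (2 * q) + 80 = 150 * q + 75 + 1 * 6 - 1 by omega]
    exact h
  · have h := not_posRootLawAt_of_certificateT_add (by omega) (chainO q) 1
    rw [show 4 * (2 * q + 1) + 6 = 8 * q + 8 + 1 + 1 by ring, show 75 * (2 * q + 1) + 80 = 150 * q + 150 + 1 * 6 - 1 by omega]
    exact h

/-- **`K = 4j+7`: `ζ_sym(6, 4j+7) ≥ 75(j+1) + 27`** (terminal block = the `(6,3)` native `S-6-3`, straight on a `(3,3)` end, reversed on a `(4,2)` end).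
[folklore] -/
theorem row_r2 (j : ℕ) : ¬ PosRootLawAt 6 (4 * j + 7) (75 * j + 101) := by
  obtain ⟨q, rfl | rfl⟩ := Nat.even_or_odd' j
  · have h := Chain.not_posRootLawAt_of_certificateT (by omega)
      (Chain.chain_append (K₁ := 8 * q + 4) (K₂ := 2) (by norm_num) (chainE q) AtomM6K3S63.block
        (Equiv.refl (Fin 6)) (by intro i; fin_cases i <;> norm_num))
    rw [show 4 * (2 * q) + 7 = 8 * q + 4 + 2 + 1 by ring, show 75 * (2 * q) + 101 = 150 * q + 75 + 27 - 1 by omega]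
    exact h
  · have h := Chain.not_posRootLawAt_of_certificateT (by omega)
      (Chain.chain_append (K₁ := 8 * q + 8) (K₂ := 2) (by norm_num) (chainO q) (block_reverse AtomM6K3S63.block)
        (Equiv.refl (Fin 6)) (by intro i; fin_cases i <;> norm_num))
    rw [show 4 * (2 * q + 1) + 7 = 8 * q + 8 + 2 + 1 by ring, show 75 * (2 * q + 1) + 101 = 150 * q + 150 + 27 - 1 by omega]
    exact h

/-- **`K = 4j+8`: `ζ_sym(6, 4j+8) ≥ 75(j+1) + 53`** (terminal block = `QUADFLAG53`, reversed on a `(3,3)` end, straight on a `(4,2)` end; `j = 0` is the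
kernel's `(6,8) ≥ 128`). [folklore] -/
theorem row_r3 (j : ℕ) : ¬ PosRootLawAt 6 (4 * j + 8) (75 * j + 127) := by
  obtain ⟨q, rfl | rfl⟩ := Nat.even_or_odd' j
  · have h := Chain.not_posRootLawAt_of_certificateT (by omega)
      (Chain.chain_append (K₁ := 8 * q + 4) (K₂ := 3) (by norm_num) (chainE q) (block_reverse AtomM6K4QF53.block)
        (Equiv.refl (Fin 6)) (by intro i; fin_cases i <;> norm_num))
    rw [show 4 * (2 * q) + 8 = 8 * q + 4 + 3 + 1 by ring, show 75 * (2 * q) + 127 = 150 * q + 75 + 53 - 1 by omega]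
    exact h
  · have h := Chain.not_posRootLawAt_of_certificateT (by omega)
      (Chain.chain_append (K₁ := 8 * q + 8) (K₂ := 3) (by norm_num) (chainO q) AtomM6K4QF53.block
        (Equiv.refl (Fin 6)) (by intro i; fin_cases i <;> norm_num))
    rw [show 4 * (2 * q + 1) + 8 = 8 * q + 8 + 3 + 1 by ring, show 75 * (2 * q + 1) + 127 = 150 * q + 150 + 53 - 1 by omega]
    exact h

/-! ### The law -/

/-- **THE `m = 6` ROW LAW (closed form).**  For every `K ≥ 5`: `¬ PosRootLawAt 6 K (75·⌊(K−1)/4⌋ + 6·((K−1) mod 4) − 1)` — some real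
symmetric `K`-letter `6 × 6` lacunary pencil has at least `75·⌊(K−1)/4⌋ + 6·((K−1) mod 4)` distinct positive determinant roots (the residue rows
`row_r2` / `row_r3` are sharper: `+27`, `+53`).  A LOWER bound in census currency; nothing about the crux `MatrixDescartes`. [folklore] -/
theorem rowLaw (K : ℕ) (hK : 5 ≤ K) : ¬ PosRootLawAt 6 K (75 * ((K - 1) / 4) + 6 * ((K - 1) % 4) - 1) := by
  obtain ⟨j, r, hr, rfl⟩ : ∃ j r, r < 4 ∧ K = 4 * j + 5 + r :=
    ⟨(K - 5) / 4, (K - 5) % 4, Nat.mod_lt _ (by norm_num), by omega⟩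
  rcases hr_cases : r with _ | _ | _ | _ | r'
  · exact mono (row_r0 j) (by omega)
  · exact mono (row_r1 j) (by omega)
  · exact mono (row_r2 j) (by omega)
  · exact mono (row_r3 j) (by omega)
  · omega

/-- **Linear form**: `ζ_sym(6,K) ≥ 18K − 27` for every `K ≥ 5` (`¬ PosRootLawAt 6 K (18K − 28)`) — against the tree's `VSQ.gen_law` `16K − 31`;
`K = 4` is `QUADFLAG53 = 53` (`…CensusM6K4QF53`). [folklore] -/
theorem rowLaw_linear (K : ℕ) (hK : 5 ≤ K) : ¬ PosRootLawAt 6 K (18 * K - 28) := by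
  obtain ⟨j, r, hr, rfl⟩ : ∃ j r, r < 4 ∧ K = 4 * j + 5 + r :=
    ⟨(K - 5) / 4, (K - 5) % 4, Nat.mod_lt _ (by norm_num), by omega⟩
  rcases hr_cases : r with _ | _ | _ | _ | r'
  · exact mono (row_r0 j) (by omega)
  · exact mono (row_r1 j) (by omega)
  · exact mono (row_r2 j) (by omega)
  · exact mono (row_r3 j) (by omega)
  · omega

/-! ### Numeral cells beyond the kernel's table (census format `(m,K) ≥ B + 1` reads `¬ PosRootLawAt m K B`) -/

/-- `ζ_sym(6,14) ≥ 231`. [folklore] -/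
theorem row_6_14 : ¬ PosRootLawAt 6 14 230 := row_r1 2

/-- `ζ_sym(6,15) ≥ 252`. [folklore] -/
theorem row_6_15 : ¬ PosRootLawAt 6 15 251 := row_r2 2

/-- `ζ_sym(6,16) ≥ 278`. [folklore] -/
theorem row_6_16 : ¬ PosRootLawAt 6 16 277 := row_r3 2

/-- `ζ_sym(6,17) ≥ 300`. [folklore] -/
theorem row_6_17 : ¬ PosRootLawAt 6 17 299 := row_r0 3

end Summit.ValiantsHypothesis.ValiantsHypothesis.Theorems.LacunarySymmetroidMatrixDescartes.Census.Reflect.RowLawM6
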